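import Summits.CriticalPhenomena.Ising3DConformalLimit.Theses.GaussianScaleMixture

/-!
# `stub_rotationsFromTwoCircles` of line `two-crystals-generate-so3` (crux `RotationUpgradeFromTwoPoint`,
stmt-CriticalPhenomena-8367) — kernel-checked verification by the deep-refute seat

Statement copied VERBATIM from `Cruxes/RotationUpgradeFromTwoPoint/Lines/two-crystals-generate-so3.lean`
(gen 2). Proof (the lead's sketch, made formal): the invariance set `Γ` is closed under composition
and inverses; the two circles act transitively on the unit sphere (an `R_x` kills the third coordinate
of `W⁻¹u`, an `R_z` turns it to `e₀`); the given coordinate reflection is `((ℝ ∙ e₀)ᗮ).reflection`;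
conjugating it by `Γ` gives every reflection `((ℝ ∙ v)ᗮ).reflection` (`Submodule.reflection_map_apply`,
`Submodule.map_orthogonal_equiv`); Cartan–Dieudonné (`LinearIsometryEquiv.reflections_generate_dim`)
finishes. Candidate proof for the worker holding the stub (refuters do not land positive statements).
-/

noncomputable section

open Literature.Probability.LatticeModels Set

namespace Summit.CriticalPhenomena.Ising3DConformalLimit.Cruxes.RotationUpgradeFromTwoPoint.DrefuteTwoCrystals

local notation "E3" => EuclideanSpace ℝ (Fin 3)

/-! ### Angles with prescribed cosine and sine -/

/-- A point of the unit circle is `(cos φ, sin φ)`. [folklore] -/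
theorem exists_cos_sin {p q : ℝ} (h : p ^ 2 + q ^ 2 = 1) :
    ∃ φ : ℝ, Real.cos φ = p ∧ Real.sin φ = q := by
  set z : ℂ := ⟨p, q⟩ with hz
  have hz0 : z ≠ 0 := by
    intro h0
    have hp : p = 0 := by simpa [hz] using congrArg Complex.re h0
    have hq : q = 0 := by simpa [hz] using congrArg Complex.im h0
    rw [hp, hq] at h
    norm_num at h
  have hn2 : ‖z‖ ^ 2 = 1 := by
    rw [Complex.sq_norm, hz, Complex.normSq_mk]
    linear_combination h
  have hn : ‖z‖ = 1 :=
    (pow_left_inj₀ (norm_nonneg z) zero_le_one (by norm_num : (2:ℕ) ≠ 0)).1 (by rw [hn2, one_pow])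
  refine ⟨Complex.arg z, ?_, ?_⟩
  · rw [Complex.cos_arg hz0, hn, div_one]
  · rw [Complex.sin_arg, hn, div_one]

/-! ### The invariance predicate -/

section Invariance

variable {S : CorrFamily 3}

/-- The invariance predicate. [folklore] -/
def Inv3 (S : CorrFamily 3) (T : E3 → E3) : Prop :=
  ∀ (n : ℕ) (x : Fin n → E3), S n (fun i => T (x i)) = S n x

/-- Invariances compose. [folklore] -/
theorem Inv3.comp {A B : E3 → E3} (hA : Inv3 S A) (hB : Inv3 S B) : Inv3 S (fun x => A (B x)) := by
  intro n x
  rw [show (fun i => A (B (x i))) = fun i => A ((fun i => B (x i)) i) from rfl, hA, hB]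

/-- Invariance passes to the inverse of an isometry. [folklore] -/
theorem Inv3.symm {R : E3 ≃ₗᵢ[ℝ] E3} (hR : Inv3 S R) : Inv3 S R.symm := by
  intro n x
  have := hR n (fun i => R.symm (x i))
  simpa using this.symm

/-- Invariance is extensional. [folklore] -/
theorem Inv3.congr {A B : E3 → E3} (hA : Inv3 S A) (h : ∀ x, A x = B x) : Inv3 S B := by
  intro n x
  have := hA n x
  simpa [h] using this

/-- A product of invariances is an invariance. [folklore] -/
theorem inv3_list_prod : ∀ l : List (E3 ≃ₗᵢ[ℝ] E3), (∀ T ∈ l, Inv3 S T) →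
    Inv3 S (l.prod : E3 ≃ₗᵢ[ℝ] E3)
  | [], _ => by intro n x; rfl
  | (T :: l), h => by
      have hT : Inv3 S T := h T (by simp)
      have hl : Inv3 S (l.prod : E3 ≃ₗᵢ[ℝ] E3) := inv3_list_prod l fun T' hT' => h T' (by simp [hT'])
      rw [List.prod_cons]
      exact (hT.comp hl).congr fun x => rfl

end Invariance

/-! ### The coordinate reflection -/

/-- `e₀ = (1,0,0)`. [folklore] -/
def e0 : E3 := WithLp.toLp 2 ![1, 0, 0]

theorem inner_e0 (x : E3) : inner ℝ e0 x = x 0 := by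
  rw [PiLp.inner_apply, Fin.sum_univ_three]
  simp [e0]

theorem norm_e0 : ‖e0‖ = 1 := by
  rw [EuclideanSpace.norm_eq, Fin.sum_univ_three]
  simp [e0]

/-- The reflection in `(ℝ ∙ e₀)ᗮ` is `(x₀,x₁,x₂) ↦ (-x₀,x₁,x₂)`. [folklore] -/
theorem reflection_e0_apply (x : E3) :
    ((ℝ ∙ e0)ᗮ).reflection x = WithLp.toLp 2 ![-x 0, x 1, x 2] := by
  rw [Submodule.reflection_orthogonal_apply, Submodule.reflection_singleton_apply, inner_e0, norm_e0]
  ext j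
  fin_cases j
  · simp [e0]; ring
  · simp [e0]
  · simp [e0]

/-- Reflections in equal subspaces agree (the `HasOrthogonalProjection` instance is a `Prop`). [folklore] -/
theorem reflection_congr_apply {K₁ K₂ : Submodule ℝ E3} [K₁.HasOrthogonalProjection]
    [K₂.HasOrthogonalProjection] (h : K₁ = K₂) (x : E3) : K₁.reflection x = K₂.reflection x := by
  subst h; rfl

/-! ### The theorem -/

/-- **`stub_rotationsFromTwoCircles`** (verbatim). [folklore] -/
theorem rotationsFromTwoCircles_holds :
  ∀ (Rz Rx : ℝ → E3 → E3),
    (∀ φ x, Rz φ x = WithLp.toLp 2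
      ![Real.cos φ * x 0 - Real.sin φ * x 1, Real.sin φ * x 0 + Real.cos φ * x 1, x 2]) →
    (∀ φ x, Rx φ x = WithLp.toLp 2
      ![x 0, Real.cos φ * x 1 - Real.sin φ * x 2, Real.sin φ * x 1 + Real.cos φ * x 2]) →
    ∀ (S : CorrFamily 3) (W : E3 ≃ₗᵢ[ℝ] E3),
    (∀ φ : ℝ, ∃ T : E3 ≃ₗᵢ[ℝ] E3, (∀ x, T (W x) = W (Rz φ x)) ∧
      ∀ (n : ℕ) (x : Fin n → E3), S n (fun i => T (x i)) = S n x) →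
    (∀ φ : ℝ, ∃ T : E3 ≃ₗᵢ[ℝ] E3, (∀ x, T (W x) = W (Rx φ x)) ∧
      ∀ (n : ℕ) (x : Fin n → E3), S n (fun i => T (x i)) = S n x) →
    (∃ F : E3 ≃ₗᵢ[ℝ] E3, (∀ x, F x = WithLp.toLp 2 ![-x 0, x 1, x 2]) ∧
      ∀ (n : ℕ) (x : Fin n → E3), S n (fun i => F (x i)) = S n x) →
    IsRotationInvariant S := by
  intro Rz Rx hRz hRx S W hZ hX hF
  -- Step 1: transitivity — every unit vector is moved to `W e₀` by an invariance
  have key : ∀ u : E3, ‖u‖ = 1 → ∃ γ : E3 ≃ₗᵢ[ℝ] E3, Inv3 S γ ∧ γ u = W e0 := by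
    intro u hu
    set u' : E3 := W.symm u with hu'
    have huW : u = W u' := (W.apply_symm_apply u).symm
    have hnorm' : ‖u'‖ = 1 := by rw [hu', LinearIsometryEquiv.norm_map, hu]
    set a := u' 0 with ha
    set b := u' 1 with hb
    set c := u' 2 with hc
    have habc : a ^ 2 + b ^ 2 + c ^ 2 = 1 := by
      have h := EuclideanSpace.real_norm_sq_eq u'
      rw [hnorm', one_pow, Fin.sum_univ_three] at h
      rw [ha, hb, hc]; linarith
    set r := Real.sqrt (b ^ 2 + c ^ 2) with hr
    have hr0 : 0 ≤ r := Real.sqrt_nonneg _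
    have hr2 : r ^ 2 = b ^ 2 + c ^ 2 := Real.sq_sqrt (by positivity)
    -- the `R_x` angle
    have hφ₁ : ∃ φ₁ : ℝ, Real.cos φ₁ * b - Real.sin φ₁ * c = r ∧
        Real.sin φ₁ * b + Real.cos φ₁ * c = 0 := by
      by_cases hr00 : r = 0
      · have hbc : b ^ 2 + c ^ 2 = 0 := by rw [← hr2, hr00]; ring
        have hb0 : b = 0 := by nlinarith [sq_nonneg b, sq_nonneg c]
        have hc0 : c = 0 := by nlinarith [sq_nonneg b, sq_nonneg c]
        exact ⟨0, by rw [hb0, hc0, hr00]; simp⟩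
      · obtain ⟨φ₁, h1, h2⟩ := exists_cos_sin (p := b / r) (q := -c / r) (by
          field_simp; linarith [hr2])
        refine ⟨φ₁, ?_, ?_⟩
        · rw [h1, h2]; field_simp; linarith [hr2]
        · rw [h1, h2]; field_simp; ring
    obtain ⟨φ₁, h11, h12⟩ := hφ₁
    -- the `R_z` angle
    have har : a ^ 2 + (-r) ^ 2 = 1 := by rw [neg_sq, hr2, ← habc]; ring
    obtain ⟨φ₂, h21, h22⟩ := exists_cos_sin har
    obtain ⟨T₁, hT₁W, hT₁⟩ := hX φ₁
    obtain ⟨T₂, hT₂W, hT₂⟩ := hZ φ₂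
    refine ⟨T₁.trans T₂, ?_, ?_⟩
    · intro n x
      show S n (fun i => T₂ (T₁ (x i))) = S n x
      exact (Inv3.comp (S := S) hT₂ hT₁) n x
    · show T₂ (T₁ u) = W e0
      have h1 : Rx φ₁ u' = WithLp.toLp 2 ![a, r, 0] := by
        rw [hRx]
        ext j; fin_cases j
        · simp [ha]
        · simpa [hb, hc] using h11
        · simpa [hb, hc] using h12
      have h2 : Rz φ₂ (WithLp.toLp 2 ![a, r, 0]) = e0 := by
        rw [hRz, h21, h22]
        ext j; fin_cases j
        · simp [e0]; nlinarith [har]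
        · simp [e0]; ring
        · simp [e0]
      rw [huW, hT₁W, h1, hT₂W, h2]
  -- Step 2: every unit vector is the image of `e₀` under an invariance
  have key2 : ∀ v : E3, ‖v‖ = 1 → ∃ η : E3 ≃ₗᵢ[ℝ] E3, Inv3 S η ∧ η e0 = v := by
    intro v hv
    obtain ⟨γ₀, hγ₀, hγ₀e⟩ := key e0 norm_e0
    obtain ⟨γ, hγ, hγv⟩ := key v hv
    refine ⟨γ₀.trans γ.symm, ?_, ?_⟩
    · intro n x
      show S n (fun i => γ.symm (γ₀ (x i))) = S n x
      exact (Inv3.comp (S := S) hγ.symm hγ₀) n x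
    · show γ.symm (γ₀ e0) = v
      rw [hγ₀e, ← hγv, LinearIsometryEquiv.symm_apply_apply]
  -- Step 3: the coordinate reflection, then every reflection, is an invariance
  have hs0 : Inv3 S ((ℝ ∙ e0)ᗮ).reflection := by
    obtain ⟨F, hFx, hFinv⟩ := hF
    exact Inv3.congr (A := F) hFinv fun x => by rw [hFx, reflection_e0_apply]
  have hrefl : ∀ v : E3, Inv3 S ((ℝ ∙ v)ᗮ).reflection := by
    intro v
    by_cases hv : v = 0
    · -- `(ℝ ∙ 0)ᗮ = ⊤`, whose reflection is the identity
      refine Inv3.congr (A := fun x => x) (fun n x => rfl) fun x => ?_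
      symm
      apply Submodule.reflection_mem_subspace_eq_self
      rw [Submodule.mem_orthogonal_singleton_iff_inner_right, hv, inner_zero_left]
    · set u : E3 := ‖v‖⁻¹ • v with hu
      have hvn : ‖v‖ ≠ 0 := norm_ne_zero_iff.2 hv
      have hun : ‖u‖ = 1 := by rw [hu]; exact norm_smul_inv_norm hv
      obtain ⟨η, hη, hηe⟩ := key2 u hun
      -- `(ℝ ∙ v) = (ℝ ∙ u) = (ℝ ∙ e₀).map η`
      have hspan : (ℝ ∙ v) = (ℝ ∙ u) := by
        rw [hu]
        exact (Submodule.span_singleton_smul_eq (isUnit_iff_ne_zero.2 (inv_ne_zero hvn)) v).symm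
      have hmap : (ℝ ∙ e0).map (η.toLinearEquiv : E3 →ₗ[ℝ] E3) = (ℝ ∙ u) := by
        rw [Submodule.map_span, Set.image_singleton]
        simp [hηe]
      have horth : (ℝ ∙ v)ᗮ = ((ℝ ∙ e0)ᗮ).map (η.toLinearEquiv : E3 →ₗ[ℝ] E3) := by
        rw [Submodule.map_orthogonal_equiv, hmap, hspan]
      have hpt : ∀ x, ((ℝ ∙ v)ᗮ).reflection x = η (((ℝ ∙ e0)ᗮ).reflection (η.symm x)) := by
        intro x
        rw [reflection_congr_apply horth x, Submodule.reflection_map_apply]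
      refine Inv3.congr (A := fun x => η (((ℝ ∙ e0)ᗮ).reflection (η.symm x))) ?_ fun x => (hpt x).symm
      exact (hη.comp hs0).comp hη.symm
  -- Step 4: Cartan–Dieudonné
  intro n R x
  obtain ⟨l, -, hl⟩ := R.reflections_generate_dim
  have hR : Inv3 S R := by
    rw [hl]
    refine inv3_list_prod _ fun T hT => ?_
    obtain ⟨v, -, rfl⟩ := List.mem_map.1 hT
    exact hrefl v
  exact hR n x

end Summit.CriticalPhenomena.Ising3DConformalLimit.Cruxes.RotationUpgradeFromTwoPoint.DrefuteTwoCrystals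

end
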